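import Literature.AlgebraicGeometry.ShimuraVarieties.UnitaryShimuraCurveHeckeConeTransport
import Literature.AlgebraicGeometry.ShimuraVarieties.UnitaryBallConeCotangentForms
import Literature.AlgebraicGeometry.HodgeTheory.OneZeroFormOfClass
import Literature.NumberTheory.Automorphic.UnitaryGroupAdelicLiftTranslate
import Literature.NumberTheory.Automorphic.UnitaryGroupArchSection
import HarnessLib

/-!
# Hecke equivariance of the cone realisation of `H¹` of the unitary Shimura CURVE: `Φ_K[T(g)^* z] = R_g Φ_{K'}[z]`

Topic `AlgebraicGeometry/ShimuraVarieties`, namespace `…ShimuraVarieties.UnitaryCanonicalModel`.  THEOREMS ONLY about explicit expressions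
(no definition, no named fact, no instance, no notation, no `sorry`); leg R5 of the record-side realisation (cell `hodgecm-mathlib`, P5 line
`F0_AlbCm`, sub-line S1-R, M5-rec F2 (iii) of the design memo `DESIGN-M5rec`).

For the curve record `S : RecordSystemGS L J⋆ τ K₀`, a level `K`, `pieces` data `(g_q, X_q, ι_q, B_q)` (hypotheses in the shape of ★
`RecordSystemGS.pieces`) and a τ-frame `(v₀, t₀)`, the PIECE FUNCTION of a class `z ∈ H¹((M_K)_τ(ℂ); ℂ)` on the piece `q` is the cone read
(★ `UnitaryBallConeCotangentForms`) of the holomorphic `1`-form `ω_q` of the `(1,0)`-part of `ι_q(ℂ)^* z` (★ `OneZeroFormOfClass`, on the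
algebraic-chart model ★ `algebraicModel`):

  `P_{K,q}[z](m) := (ω_q (ι_q(ℂ)^* z))_{ψ_q(m v₀)} (dψ_q,_{m v₀} (m t₀))`,  `ψ_q = (B_q).unif` read in `X_q(ℂ)`,  `m ∈ M₂(ℂ)`,

and the family fed to the adelic lift (★ `UnitaryGroupAdelicLift`) is `u ↦ P_{K,q}[z](ũ)`, `ũ := u` untwisted to `τ`-coordinates entrywise by
★ `embTwist` (`u ∈ U(J⋆^{σ})(ℂ)`, `σ = ` Mathlib's embedding of the place of `τ`).  We prove:

* §1 `map_embTwist_rationalToArchLocal_mul` — `(σ(γ) u)~ = γ^τ · ũ` (★ `embTwist_embedding_apply`), and `ũ` is `J⋆^τ`-unitary, so `ũ v₀` is negative;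
* §2 `pieceFun_heckePullback_eq` — for a Hecke translate `Tg` (`S.IsHeckeTranslate K K' g Tg`, `g⁻¹Kg ≤ K'`), pieces at `K` and `K'`, and
  `(γ_f · g_q g)⁻¹ · g'_{q'} ∈ K'`:  **`P_{K,q}[T_ℂ(ℂ)^* z](m) = P_{K',q'}[z](γ^τ · m)`** on the cone — ★ `exists_pieceHom_comp_eq` (piece morphism
  `f`, `f ≫ ι' = ι ≫ T_ℂ`), ★ `singularCohomology_map_mapContinuous_eq_of_comp_eq` (classes), ★ `oneZeroForm_map` (the `(1,0)`-form of a pulled-back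
  class is the pulled-back form), ★ `pullback_coneDeriv_ratToGLℂ_eq` (cone reads);
* §3 `lift_heckePullback_eq_rightTranslate` — for ANY lift `Φ` at level `K'` of the family of `z` and ANY lift `Ψ` at level `K` of the family of
  `T_ℂ(ℂ)^* z` (the four clauses of ★ `exists_lift_of_pieces` as hypotheses): **`Ψ = (x ↦ Φ (x · (1, g)))`**, i.e. `Ψ = R_g Φ` (★
  `apply_eq_apply_mul_finAdelicToAdelic_of_pieces'`) — the Hecke-equivariance clause of `S1RealisationShape` for the `(1,0)`-half; the `(0,1)`-half
  follows by conjugating the class (★ `conjClass_complexBetti_map`, `conjFun₂_rightRep₂`);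
* §4 `family_rationalToArchLocal_mul` — the family is `Γ_q`-INVARIANT (hypothesis `hf` of ★ `exists_lift_of_pieces`): `δ_f · g_q ∈ g_q · K` ⇒
  `P_{K,q}[α]((σ(δ) u)~) = P_{K,q}[α](ũ)` (★ `conePullback_act`, the `pieces` level clause, ★ `mem_arithmeticLevel_iff`) — so the lifts EXIST.

## References
* [Milne2005ShimuraVarieties] J. S. Milne, *Introduction to Shimura varieties* (2005/2017), §5 p. 57–58, Lemma 5.13, §13 p. 118 L21–26.
* [BorelJacquet1979] A. Borel, H. Jacquet, Corvallis PSPM 33.1 (1979), §4.2–§4.3.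
* [Borel1997] A. Borel, *Automorphic forms on SL₂(ℝ)* (1997), §5.13–§5.14.
* [VoisinHodgeI2002] C. Voisin, *Hodge Theory and Complex Algebraic Geometry I* (2002), §6.1.3 Cor. 6.14, §7.1.1, §7.3.2.
* [Deligne1979ShimuraVarieties] P. Deligne, Corvallis PSPM 33.2 (1979), 2.1.2 (the pieces `Γ_g \ X⁺`).
* [BergeronMillsonMoeglin2016Balls] N. Bergeron, J. Millson, C. Moeglin, Acta Math. 216 (2016), Part 2 §1.3.
-/

set_option autoImplicit false

noncomputable section

open Function MulAction Topology NumberField CategoryTheory Matrix AlgebraicGeometry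
open scoped Matrix ComplexOrder Manifold
open Literature.AlgebraicGeometry.Motives
open Literature.NumberTheory.Automorphic Literature.NumberTheory.Automorphic.UnitaryGroup
open Literature.NumberTheory.Automorphic.Liu2021.AppendixC (C5.OpenCompactSubgroup C5.SmallLevel)
open Literature.AlgebraicGeometry.HodgeTheory
open Literature.Geometry.Kaehler (MForm)
open Literature.AlgebraicTopology.SingularHomology

namespace Literature.AlgebraicGeometry.ShimuraVarieties.UnitaryCanonicalModel

variable {L : Type} [Field L] [NumberField L] [IsCMField L] {Jstar : Matrix (Fin 2) (Fin 2) L} {τ : L →+* ℂ}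
  {K₀ : C5.OpenCompactSubgroup ↥(finAdelic (↥(maximalRealSubfield L)) L (IsCMField.complexConj L) 2 Jstar)}

/-! ### §1 Untwisting the archimedean coordinate: `ũ := embTwist ∘ u` -/

/-- **`(σ(γ) · u)~ = γ^τ · ũ`**: untwisting the product of a rational element (embedded by Mathlib's `σ` of the place of `τ`) with an archimedean
`u` gives the `τ`-matrix of `γ` times the untwisted `u` (★ `embTwist_embedding_apply`). [cite: BorelJacquet1979, §4.1] -/
theorem map_embTwist_rationalToArchLocal_mul (γ : ↥(rational (↥(maximalRealSubfield L)) L (IsCMField.complexConj L) 2 Jstar))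
    (u : archLocal L 2 Jstar (cmPlace L τ)) :
    (((rationalToArchLocal (↥(maximalRealSubfield L)) L (IsCMField.complexConj L) 2 Jstar (cmPlace L τ)
          (complexConj_smul_infinitePlace L _) (IsCMField.complexConj_ne_one L) γ * u : archLocal L 2 Jstar (cmPlace L τ)) :
        GL (Fin 2) ℂ) : Matrix (Fin 2) (Fin 2) ℂ).map (embTwist L τ) =
      ((ratToGLℂ L Jstar τ γ : GL (Fin 2) ℂ) : Matrix (Fin 2) (Fin 2) ℂ) * (((u : GL (Fin 2) ℂ) : Matrix (Fin 2) (Fin 2) ℂ).map (embTwist L τ)) := by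
  rw [Subgroup.coe_mul, Units.val_mul, Matrix.map_mul, coe_rationalToArchLocal, coe_ratToGLℂ]
  congr 1
  ext i j
  simp only [Matrix.map_apply, Matrix.GeneralLinearGroup.map_apply, embTwist_embedding_apply]

/-- **`ũ` is `J⋆^τ`-unitary**: `ũᴴ J⋆^τ ũ = J⋆^τ` (`u` is `σ(J⋆)`-unitary, `embTwist` is a ring map commuting with conjugation, and
`embTwist(σ(J⋆)) = J⋆^τ`, ★ `map_map_embTwist`). [cite: BorelJacquet1979, §4.1] -/
theorem conjTranspose_map_embTwist_mul (u : archLocal L 2 Jstar (cmPlace L τ)) :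
    ((((u : GL (Fin 2) ℂ) : Matrix (Fin 2) (Fin 2) ℂ).map (embTwist L τ)))ᴴ * Jstar.map τ *
        (((u : GL (Fin 2) ℂ) : Matrix (Fin 2) (Fin 2) ℂ).map (embTwist L τ)) = Jstar.map τ := by
  have hu := mem_unitaryGroupOfForm_iff.1 u.2
  -- apply `embTwist` entrywise to `uᴴ σ(J⋆) u = σ(J⋆)`
  have h := congrArg (fun N : Matrix (Fin 2) (Fin 2) ℂ => N.map (embTwist L τ)) hu
  simp only [Matrix.map_mul] at h
  have hJ : (Jstar.map (cmPlace L τ).1.embedding).map (embTwist L τ) = Jstar.map τ := by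
    rw [← map_map_embTwist L 2 Jstar τ (isComplex_mk_of_isCMField L τ), Matrix.map_map]
    conv_rhs => rw [← Matrix.map_id (Jstar.map τ)]
    exact congrArg _ (funext fun z => embTwist_embTwist L τ z)
  have hT : ((((u : GL (Fin 2) ℂ) : Matrix (Fin 2) (Fin 2) ℂ).map (starRingEnd ℂ))ᵀ).map (embTwist L τ) =
      ((((u : GL (Fin 2) ℂ) : Matrix (Fin 2) (Fin 2) ℂ).map (embTwist L τ)))ᴴ := by
    ext i j
    simp only [Matrix.map_apply, transpose_apply, conjTranspose_apply, Complex.star_def, embTwist_conj]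
  rw [hJ, hT] at h
  exact h

/-- `ũ v` is negative for `J⋆^τ` when `v` is (unitary matrices preserve the cone). [cite: BergeronMillsonMoeglin2016Balls, Part 2 §1.3] -/
theorem map_embTwist_mulVec_mem_negCone (u : archLocal L 2 Jstar (cmPlace L τ)) {v : Fin 2 → ℂ} (hv : v ∈ negCone (Jstar.map τ)) :
    (((u : GL (Fin 2) ℂ) : Matrix (Fin 2) (Fin 2) ℂ).map (embTwist L τ)) *ᵥ v ∈ negCone (Jstar.map τ) := by
  change (star ((((u : GL (Fin 2) ℂ) : Matrix (Fin 2) (Fin 2) ℂ).map (embTwist L τ)) *ᵥ v) ⬝ᵥ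
    (Jstar.map τ *ᵥ ((((u : GL (Fin 2) ℂ) : Matrix (Fin 2) (Fin 2) ℂ).map (embTwist L τ)) *ᵥ v))).re < 0
  have h := Matrix.re_star_dotProduct_mulVec_mulVec (conjTranspose_map_embTwist_mul (τ := τ) u) v
  rw [RCLike.re_to_complex] at h
  rw [h]
  exact hv

/-! ### §2 The piece function of a pulled-back class is the translated piece function -/

section Pieces

variable {S : RecordSystemGS L Jstar τ K₀} {K K' : C5.SmallLevel K₀}
  {g : ↥(finAdelic (↥(maximalRealSubfield L)) L (IsCMField.complexConj L) 2 Jstar)} {Tg : S.M.obj K ⟶ S.M.obj K'}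
  {Q : Type} {gq : Q → ↥(finAdelic (↥(maximalRealSubfield L)) L (IsCMField.complexConj L) 2 Jstar)} {X : Q → SchemeOver ℂ}
  {ι : ∀ q, X q ⟶ (letI : Algebra L ℂ := τ.toAlgebra; (Motives.baseChangeHom τ).obj (S.M.obj K))}
  {B : ∀ q, UnitaryBallUniformisationDatum 1 (X q)}
  {Q' : Type} {gq' : Q' → ↥(finAdelic (↥(maximalRealSubfield L)) L (IsCMField.complexConj L) 2 Jstar)} {X' : Q' → SchemeOver ℂ}
  {ι' : ∀ q', X' q' ⟶ (letI : Algebra L ℂ := τ.toAlgebra; (Motives.baseChangeHom τ).obj (S.M.obj K'))}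
  {B' : ∀ q', UnitaryBallUniformisationDatum 1 (X' q')}

/-- **The piece function of `T_ℂ(ℂ)^* z` on the piece `q` of level `K` is the piece function of `z` on the piece `q'` of level `K'`,
translated by `γ^τ`** (for `(γ_f · g_q g)⁻¹ · g'_{q'} ∈ K'`): with `ω` the `(1,0)`-form of a class on the algebraic-chart models,
`(ω_q(ι_q^* T_ℂ^* z))_{ψ_q(m v₀)}(dψ_q(m t₀)) = (ω_{q'}(ι'_{q'}^* z))_{ψ'_{q'}((γ^τ m) v₀)}(dψ'_{q'}((γ^τ m) t₀))` for `m v₀` negative.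
[cite: Milne2005ShimuraVarieties, Lemma 5.13 p. 57 and §13 p. 118 L21–26] [cite: VoisinHodgeI2002, §6.1.3 Cor. 6.14, §7.1.1 and §7.3.2] -/
theorem pieceFun_heckePullback_eq (hT : S.IsHeckeTranslate K K' g Tg) (hK : ∀ k ∈ K.1.1, g⁻¹ * k * g ∈ K'.1.1)
    (hB : letI : Algebra L ℂ := τ.toAlgebra
      ∀ q, (B q).Hℂ = Jstar.map τ ∧
        (B q).Γ.map (Matrix.GeneralLinearGroup.map ((B q).τ₁ : ↥(B q).E →+* ℂ)) =
          (arithmeticLevel (↥(maximalRealSubfield L)) L (IsCMField.complexConj L) 2 Jstar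
            (K.1.1.map (MulAut.conj (gq q)).toMonoidHom)).map (Matrix.GeneralLinearGroup.map τ) ∧
        ∀ (v : Fin 2 → ℂ) (hv : v ∈ negCone (Jstar.map τ)),
          AlgPoints.map (ι q) ((B q).unif v) =
            AlgPoints.baseChangeEquiv τ (S.M.obj K) ((S.pts K).symm (ShimuraSetGS.mk L Jstar τ K.1.1 v hv (gq q))))
    (hB' : letI : Algebra L ℂ := τ.toAlgebra
      ∀ q', (B' q').Hℂ = Jstar.map τ ∧
        (B' q').Γ.map (Matrix.GeneralLinearGroup.map ((B' q').τ₁ : ↥(B' q').E →+* ℂ)) =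
          (arithmeticLevel (↥(maximalRealSubfield L)) L (IsCMField.complexConj L) 2 Jstar
            (K'.1.1.map (MulAut.conj (gq' q')).toMonoidHom)).map (Matrix.GeneralLinearGroup.map τ) ∧
        ∀ (v : Fin 2 → ℂ) (hv : v ∈ negCone (Jstar.map τ)),
          AlgPoints.map (ι' q') ((B' q').unif v) =
            AlgPoints.baseChangeEquiv τ (S.M.obj K') ((S.pts K').symm (ShimuraSetGS.mk L Jstar τ K'.1.1 v hv (gq' q'))))
    {q : Q} {q' : Q'} {γ : ↥(rational (↥(maximalRealSubfield L)) L (IsCMField.complexConj L) 2 Jstar)}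
    (hγ : ((rationalToFinAdelic (↥(maximalRealSubfield L)) L (IsCMField.complexConj L) 2 Jstar γ :
        ↥(finAdelic (↥(maximalRealSubfield L)) L (IsCMField.complexConj L) 2 Jstar)) * (gq q * g))⁻¹ * gq' q' ∈ K'.1.1)
    (z : letI : Algebra L ℂ := τ.toAlgebra; complexBetti ((Motives.baseChangeHom τ).obj (S.M.obj K')) 1)
    (v₀ t₀ : Fin 2 → ℂ) {m : Matrix (Fin 2) (Fin 2) ℂ} (hm : m *ᵥ v₀ ∈ negCone (Jstar.map τ)) :
    letI : Algebra L ℂ := τ.toAlgebra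
    ((algebraicModel (B q).isSmoothProjective).oneFormOfClass (B q).isSmoothProjective (algebraicModel (B q).isSmoothProjective).holFormsClosed_top
        (((algebraicModel (B q).isSmoothProjective).complexification (B q).isSmoothProjective 1).symm
          ((algebraicModel (B q).isSmoothProjective).pullbackEquiv 1
            ((algebraicModel (B q).isSmoothProjective).typeProj 1 ⟨(1, 0), Finset.HasAntidiagonal.mem_antidiagonal.2 rfl⟩
              (complexBetti.map (ι q ≫ (Motives.baseChangeHom τ).map Tg) 1 z)))) :
          MForm 𝓘(ℝ, (algebraicModel (B q).isSmoothProjective).model) (algebraicModel (B q).isSmoothProjective).carrier ℂ 1)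
        ((⇑(algebraicModel (B q).isSmoothProjective).isAnalytification.homeomorph.symm ∘ (B q).unif) (m *ᵥ v₀))
        (fun _ ↦ mfderiv 𝓘(ℝ, Fin 2 → ℂ) 𝓘(ℝ, (algebraicModel (B q).isSmoothProjective).model)
          (⇑(algebraicModel (B q).isSmoothProjective).isAnalytification.homeomorph.symm ∘ (B q).unif) (m *ᵥ v₀) (m *ᵥ t₀)) =
      ((algebraicModel (B' q').isSmoothProjective).oneFormOfClass (B' q').isSmoothProjective
          (algebraicModel (B' q').isSmoothProjective).holFormsClosed_top
        (((algebraicModel (B' q').isSmoothProjective).complexification (B' q').isSmoothProjective 1).symm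
          ((algebraicModel (B' q').isSmoothProjective).pullbackEquiv 1
            ((algebraicModel (B' q').isSmoothProjective).typeProj 1 ⟨(1, 0), Finset.HasAntidiagonal.mem_antidiagonal.2 rfl⟩
              (complexBetti.map (ι' q') 1 z)))) :
          MForm 𝓘(ℝ, (algebraicModel (B' q').isSmoothProjective).model) (algebraicModel (B' q').isSmoothProjective).carrier ℂ 1)
        ((⇑(algebraicModel (B' q').isSmoothProjective).isAnalytification.homeomorph.symm ∘ (B' q').unif)
          (((((ratToGLℂ L Jstar τ γ : GL (Fin 2) ℂ) : Matrix (Fin 2) (Fin 2) ℂ)) * m) *ᵥ v₀))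
        (fun _ ↦ mfderiv 𝓘(ℝ, Fin 2 → ℂ) 𝓘(ℝ, (algebraicModel (B' q').isSmoothProjective).model)
          (⇑(algebraicModel (B' q').isSmoothProjective).isAnalytification.homeomorph.symm ∘ (B' q').unif)
          (((((ratToGLℂ L Jstar τ γ : GL (Fin 2) ℂ) : Matrix (Fin 2) (Fin 2) ℂ)) * m) *ᵥ v₀)
          (((((ratToGLℂ L Jstar τ γ : GL (Fin 2) ℂ) : Matrix (Fin 2) (Fin 2) ℂ)) * m) *ᵥ t₀)) := by
  letI : Algebra L ℂ := τ.toAlgebra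
  -- the piece morphism under the translate
  obtain ⟨f, hf, hcomp⟩ := exists_pieceHom_comp_eq hT hK hB hB' hγ
  -- classes: `(ι_q ≫ T_ℂ)^* z = f^* (ι'^* z)`
  have hz : complexBetti.map (ι q ≫ (Motives.baseChangeHom τ).map Tg) 1 z =
      complexBetti.map f 1 (complexBetti.map (ι' q') 1 z) :=
    singularCohomology_map_mapContinuous_eq_of_comp_eq hcomp 1 z
  -- forms: the `(1,0)`-form of the pulled-back class is the pulled-back form
  rw [hz, coe_oneZeroForm_map (B' q').isSmoothProjective (B q).isSmoothProjective f
    (algebraicModel (B' q').isSmoothProjective).holFormsClosed_top (algebraicModel (B q).isSmoothProjective).holFormsClosed_top]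
  -- cone reads: transport along `f`
  exact pullback_coneDeriv_ratToGLℂ_eq (hB q).1 (hB' q').1 (algebraicModel (B' q').isSmoothProjective)
    (algebraicModel (B q).isSmoothProjective) hf _ v₀ (fun _ => t₀) hm

/-! ### §3 Any lift of the family of `T_ℂ(ℂ)^* z` at level `K` is the right translate of any lift of the family of `z` at level `K'` -/

/-- **HECKE EQUIVARIANCE OF THE CONE REALISATION, `(1,0)`-half: `Ψ = R_g Φ`.**  Let `Φ` be ANY function on `U(J⋆)(𝔸_{L⁺})` with the four
properties of the adelic lift (★ `exists_lift_of_pieces`) at level `K'` for the family `u ↦ P_{K',q'}[z](ũ)` of the class `z`, and `Ψ` ANY such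
function at level `K` for the family `u ↦ P_{K,q}[T_ℂ(ℂ)^* z](ũ)` of the pulled-back class (`ũ = embTwist ∘ u`, §1); let `g⁻¹Kg ≤ K'`,
let the level-`K` representatives cover, and for every `q` let `γ_q`, `q'(q)` satisfy `(γ_{q,f} · g_q g)⁻¹ · g'_{q'(q)} ∈ K'`.  Then
`Ψ x = Φ (x · (1, g))` for every adelic `x` — §2 on every piece (`P_{K,q}[T^*z](ũ) = P_{K',q'}[z](γ^τ ũ) = P_{K',q'}[z]((σ(γ) u)~)`, §1) and
★ `apply_eq_apply_mul_finAdelicToAdelic_of_pieces'`.  This is the equivariance clause `r (rhoB g x) = rightRep₂ g (r x)` of the S1-R letter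
for the holomorphic half, at the level of the record (`rightRep₂_apply` is `rfl`).
[cite: Milne2005ShimuraVarieties, §5 p. 57–58 and §13 p. 118 L21–26] [cite: BorelJacquet1979, §4.2–§4.3] [cite: Borel1997, §5.13–§5.14] -/
theorem lift_heckePullback_eq_rightTranslate (hT : S.IsHeckeTranslate K K' g Tg) (hK : ∀ k ∈ K.1.1, g⁻¹ * k * g ∈ K'.1.1)
    (hB : letI : Algebra L ℂ := τ.toAlgebra
      ∀ q, (B q).Hℂ = Jstar.map τ ∧
        (B q).Γ.map (Matrix.GeneralLinearGroup.map ((B q).τ₁ : ↥(B q).E →+* ℂ)) =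
          (arithmeticLevel (↥(maximalRealSubfield L)) L (IsCMField.complexConj L) 2 Jstar
            (K.1.1.map (MulAut.conj (gq q)).toMonoidHom)).map (Matrix.GeneralLinearGroup.map τ) ∧
        ∀ (v : Fin 2 → ℂ) (hv : v ∈ negCone (Jstar.map τ)),
          AlgPoints.map (ι q) ((B q).unif v) =
            AlgPoints.baseChangeEquiv τ (S.M.obj K) ((S.pts K).symm (ShimuraSetGS.mk L Jstar τ K.1.1 v hv (gq q))))
    (hB' : letI : Algebra L ℂ := τ.toAlgebra
      ∀ q', (B' q').Hℂ = Jstar.map τ ∧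
        (B' q').Γ.map (Matrix.GeneralLinearGroup.map ((B' q').τ₁ : ↥(B' q').E →+* ℂ)) =
          (arithmeticLevel (↥(maximalRealSubfield L)) L (IsCMField.complexConj L) 2 Jstar
            (K'.1.1.map (MulAut.conj (gq' q')).toMonoidHom)).map (Matrix.GeneralLinearGroup.map τ) ∧
        ∀ (v : Fin 2 → ℂ) (hv : v ∈ negCone (Jstar.map τ)),
          AlgPoints.map (ι' q') ((B' q').unif v) =
            AlgPoints.baseChangeEquiv τ (S.M.obj K') ((S.pts K').symm (ShimuraSetGS.mk L Jstar τ K'.1.1 v hv (gq' q'))))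
    (hcov : ∀ y : ↥(finAdelic (↥(maximalRealSubfield L)) L (IsCMField.complexConj L) 2 Jstar),
      ∃ (q : Q) (δ : ↥(rational (↥(maximalRealSubfield L)) L (IsCMField.complexConj L) 2 Jstar))
        (k : ↥(finAdelic (↥(maximalRealSubfield L)) L (IsCMField.complexConj L) 2 Jstar)),
        k ∈ K.1.1 ∧ y = rationalToFinAdelic (↥(maximalRealSubfield L)) L (IsCMField.complexConj L) 2 Jstar δ * gq q * k)
    {q' : Q → Q'} {γ : Q → ↥(rational (↥(maximalRealSubfield L)) L (IsCMField.complexConj L) 2 Jstar)}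
    (hγ : ∀ q, ((rationalToFinAdelic (↥(maximalRealSubfield L)) L (IsCMField.complexConj L) 2 Jstar (γ q) :
        ↥(finAdelic (↥(maximalRealSubfield L)) L (IsCMField.complexConj L) 2 Jstar)) * (gq q * g))⁻¹ * gq' (q' q) ∈ K'.1.1)
    (z : letI : Algebra L ℂ := τ.toAlgebra; complexBetti ((Motives.baseChangeHom τ).obj (S.M.obj K')) 1)
    {v₀ : Fin 2 → ℂ} (hv₀ : v₀ ∈ negCone (Jstar.map τ)) (t₀ : Fin 2 → ℂ)
    {Φ Ψ : (adelicGroupData (↥(maximalRealSubfield L)) L (IsCMField.complexConj L) 2 Jstar).Adelic → ℂ}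
    (hL : ∀ (δ : ↥(rational (↥(maximalRealSubfield L)) L (IsCMField.complexConj L) 2 Jstar))
        (x : (adelicGroupData (↥(maximalRealSubfield L)) L (IsCMField.complexConj L) 2 Jstar).Adelic),
      Φ ((adelicGroupData (↥(maximalRealSubfield L)) L (IsCMField.complexConj L) 2 Jstar).toAdelic δ * x) = Φ x)
    (hKc : ∀ k ∈ ((archAt (↥(maximalRealSubfield L)) L (IsCMField.complexConj L) 2 Jstar (cmPlace L τ)
          (complexConj_smul_infinitePlace L _) (IsCMField.complexConj_ne_one L)).ker).map
        (archToAdelic (↥(maximalRealSubfield L)) L (IsCMField.complexConj L) 2 Jstar),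
      ∀ x : (adelicGroupData (↥(maximalRealSubfield L)) L (IsCMField.complexConj L) 2 Jstar).Adelic, Φ (x * k) = Φ x)
    (hK' : ∀ k ∈ K'.1.1, ∀ x : (adelicGroupData (↥(maximalRealSubfield L)) L (IsCMField.complexConj L) 2 Jstar).Adelic,
      Φ (x * finAdelicToAdelic (↥(maximalRealSubfield L)) L (IsCMField.complexConj L) 2 Jstar k) = Φ x)
    (hΦ : letI : Algebra L ℂ := τ.toAlgebra
      ∀ (q' : Q') (u : archLocal L 2 Jstar (cmPlace L τ)),
        Φ (adelicSingle (↥(maximalRealSubfield L)) L (IsCMField.complexConj L) 2 Jstar (IsCMField.complexConj_ne_one L)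
            (complexConj_smul_infinitePlace L) (cmPlace L τ) u *
          finAdelicToAdelic (↥(maximalRealSubfield L)) L (IsCMField.complexConj L) 2 Jstar (gq' q')) =
        ((algebraicModel (B' q').isSmoothProjective).oneFormOfClass (B' q').isSmoothProjective
            (algebraicModel (B' q').isSmoothProjective).holFormsClosed_top
          (((algebraicModel (B' q').isSmoothProjective).complexification (B' q').isSmoothProjective 1).symm
            ((algebraicModel (B' q').isSmoothProjective).pullbackEquiv 1
              ((algebraicModel (B' q').isSmoothProjective).typeProj 1 ⟨(1, 0), Finset.HasAntidiagonal.mem_antidiagonal.2 rfl⟩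
                (complexBetti.map (ι' q') 1 z)))) :
            MForm 𝓘(ℝ, (algebraicModel (B' q').isSmoothProjective).model) (algebraicModel (B' q').isSmoothProjective).carrier ℂ 1)
          ((⇑(algebraicModel (B' q').isSmoothProjective).isAnalytification.homeomorph.symm ∘ (B' q').unif)
            ((((u : GL (Fin 2) ℂ) : Matrix (Fin 2) (Fin 2) ℂ).map (embTwist L τ)) *ᵥ v₀))
          (fun _ ↦ mfderiv 𝓘(ℝ, Fin 2 → ℂ) 𝓘(ℝ, (algebraicModel (B' q').isSmoothProjective).model)
            (⇑(algebraicModel (B' q').isSmoothProjective).isAnalytification.homeomorph.symm ∘ (B' q').unif)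
            ((((u : GL (Fin 2) ℂ) : Matrix (Fin 2) (Fin 2) ℂ).map (embTwist L τ)) *ᵥ v₀)
            ((((u : GL (Fin 2) ℂ) : Matrix (Fin 2) (Fin 2) ℂ).map (embTwist L τ)) *ᵥ t₀)))
    (hL' : ∀ (δ : ↥(rational (↥(maximalRealSubfield L)) L (IsCMField.complexConj L) 2 Jstar))
        (x : (adelicGroupData (↥(maximalRealSubfield L)) L (IsCMField.complexConj L) 2 Jstar).Adelic),
      Ψ ((adelicGroupData (↥(maximalRealSubfield L)) L (IsCMField.complexConj L) 2 Jstar).toAdelic δ * x) = Ψ x)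
    (hKc' : ∀ k ∈ ((archAt (↥(maximalRealSubfield L)) L (IsCMField.complexConj L) 2 Jstar (cmPlace L τ)
          (complexConj_smul_infinitePlace L _) (IsCMField.complexConj_ne_one L)).ker).map
        (archToAdelic (↥(maximalRealSubfield L)) L (IsCMField.complexConj L) 2 Jstar),
      ∀ x : (adelicGroupData (↥(maximalRealSubfield L)) L (IsCMField.complexConj L) 2 Jstar).Adelic, Ψ (x * k) = Ψ x)
    (hKΨ : ∀ k ∈ K.1.1, ∀ x : (adelicGroupData (↥(maximalRealSubfield L)) L (IsCMField.complexConj L) 2 Jstar).Adelic,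
      Ψ (x * finAdelicToAdelic (↥(maximalRealSubfield L)) L (IsCMField.complexConj L) 2 Jstar k) = Ψ x)
    (hΨ : letI : Algebra L ℂ := τ.toAlgebra
      ∀ (q : Q) (u : archLocal L 2 Jstar (cmPlace L τ)),
        Ψ (adelicSingle (↥(maximalRealSubfield L)) L (IsCMField.complexConj L) 2 Jstar (IsCMField.complexConj_ne_one L)
            (complexConj_smul_infinitePlace L) (cmPlace L τ) u *
          finAdelicToAdelic (↥(maximalRealSubfield L)) L (IsCMField.complexConj L) 2 Jstar (gq q)) =
        ((algebraicModel (B q).isSmoothProjective).oneFormOfClass (B q).isSmoothProjective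
            (algebraicModel (B q).isSmoothProjective).holFormsClosed_top
          (((algebraicModel (B q).isSmoothProjective).complexification (B q).isSmoothProjective 1).symm
            ((algebraicModel (B q).isSmoothProjective).pullbackEquiv 1
              ((algebraicModel (B q).isSmoothProjective).typeProj 1 ⟨(1, 0), Finset.HasAntidiagonal.mem_antidiagonal.2 rfl⟩
                (complexBetti.map (ι q ≫ (Motives.baseChangeHom τ).map Tg) 1 z)))) :
            MForm 𝓘(ℝ, (algebraicModel (B q).isSmoothProjective).model) (algebraicModel (B q).isSmoothProjective).carrier ℂ 1)
          ((⇑(algebraicModel (B q).isSmoothProjective).isAnalytification.homeomorph.symm ∘ (B q).unif)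
            ((((u : GL (Fin 2) ℂ) : Matrix (Fin 2) (Fin 2) ℂ).map (embTwist L τ)) *ᵥ v₀))
          (fun _ ↦ mfderiv 𝓘(ℝ, Fin 2 → ℂ) 𝓘(ℝ, (algebraicModel (B q).isSmoothProjective).model)
            (⇑(algebraicModel (B q).isSmoothProjective).isAnalytification.homeomorph.symm ∘ (B q).unif)
            ((((u : GL (Fin 2) ℂ) : Matrix (Fin 2) (Fin 2) ℂ).map (embTwist L τ)) *ᵥ v₀)
            ((((u : GL (Fin 2) ℂ) : Matrix (Fin 2) (Fin 2) ℂ).map (embTwist L τ)) *ᵥ t₀)))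
    (x : (adelicGroupData (↥(maximalRealSubfield L)) L (IsCMField.complexConj L) 2 Jstar).Adelic) :
    Ψ x = Φ (x * finAdelicToAdelic (↥(maximalRealSubfield L)) L (IsCMField.complexConj L) 2 Jstar g) := by
  letI : Algebra L ℂ := τ.toAlgebra
  refine apply_eq_apply_mul_finAdelicToAdelic_of_pieces' hcov hL hKc hK' hΦ hK hγ hL' hKc' hKΨ (fun q u => ?_) x
  rw [hΨ q u, map_embTwist_rationalToArchLocal_mul (τ := τ) (γ q) u]
  exact pieceFun_heckePullback_eq hT hK hB hB' (hγ q) z v₀ t₀ (map_embTwist_mulVec_mem_negCone (τ := τ) u hv₀)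

end Pieces

/-! ### §4 The family is `Γ_q`-invariant (hypothesis `hf` of the adelic lift) -/

section Invariance

variable {S : RecordSystemGS L Jstar τ K₀} {K : C5.SmallLevel K₀}
  {Q : Type} {gq : Q → ↥(finAdelic (↥(maximalRealSubfield L)) L (IsCMField.complexConj L) 2 Jstar)} {X : Q → SchemeOver ℂ}
  {B : ∀ q, UnitaryBallUniformisationDatum 1 (X q)}

/-- A rational `δ` with `δ_f · g_q ∈ g_q · K` acts on `V⋆ ⊗_τ ℂ` through an element of the piece's group `Γ_q`: there is `γ' ∈ (B q).Γ` with
`γ'^{τ₁} = δ^τ` (the `pieces` clause reads `Γ_q` as `τ(Γ_{J⋆}(g_q K g_q⁻¹))`, ★ `mem_arithmeticLevel_iff`). [cite: Deligne1979ShimuraVarieties, 2.1.2]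
[cite: Milne2005ShimuraVarieties, Lemma 5.13 p. 57] -/
theorem exists_mem_Γ_map_eq_ratToGLℂ
    (hΓ : ∀ q, (B q).Γ.map (Matrix.GeneralLinearGroup.map ((B q).τ₁ : ↥(B q).E →+* ℂ)) =
      (arithmeticLevel (↥(maximalRealSubfield L)) L (IsCMField.complexConj L) 2 Jstar
        (K.1.1.map (MulAut.conj (gq q)).toMonoidHom)).map (Matrix.GeneralLinearGroup.map τ))
    (q : Q) {δ : ↥(rational (↥(maximalRealSubfield L)) L (IsCMField.complexConj L) 2 Jstar)}
    (hδ : ∃ k ∈ K.1.1, (rationalToFinAdelic (↥(maximalRealSubfield L)) L (IsCMField.complexConj L) 2 Jstar δ :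
        ↥(finAdelic (↥(maximalRealSubfield L)) L (IsCMField.complexConj L) 2 Jstar)) * gq q = gq q * k) :
    ∃ γ' ∈ (B q).Γ, ((γ' : Matrix (Fin 2) (Fin 2) ↥(B q).E).map (B q).τ₁) =
      ((ratToGLℂ L Jstar τ δ : GL (Fin 2) ℂ) : Matrix (Fin 2) (Fin 2) ℂ) := by
  obtain ⟨k, hk, hδk⟩ := hδ
  -- `δ ∈ Γ_{J⋆}(g_q K g_q⁻¹)`
  have hmem : ((δ : ↥(rational (↥(maximalRealSubfield L)) L (IsCMField.complexConj L) 2 Jstar)) : GL (Fin 2) L) ∈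
      arithmeticLevel (↥(maximalRealSubfield L)) L (IsCMField.complexConj L) 2 Jstar (K.1.1.map (MulAut.conj (gq q)).toMonoidHom) := by
    refine mem_arithmeticLevel_iff.2 ⟨δ.2, Subgroup.mem_map.2 ⟨k, hk, ?_⟩⟩
    rw [MulEquiv.coe_toMonoidHom, MulAut.conj_apply, ← hδk, mul_inv_cancel_right]
  -- hence `δ^τ ∈ Γ_q^{τ₁}`
  have hmem' : Matrix.GeneralLinearGroup.map τ
      ((δ : ↥(rational (↥(maximalRealSubfield L)) L (IsCMField.complexConj L) 2 Jstar)) : GL (Fin 2) L) ∈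
      (B q).Γ.map (Matrix.GeneralLinearGroup.map ((B q).τ₁ : ↥(B q).E →+* ℂ)) := by
    rw [hΓ q]
    exact Subgroup.mem_map_of_mem _ hmem
  obtain ⟨γ', hγ', hγ'δ⟩ := Subgroup.mem_map.1 hmem'
  refine ⟨γ', hγ', ?_⟩
  have h := congrArg (fun g : GL (Fin 2) ℂ => (g : Matrix (Fin 2) (Fin 2) ℂ)) hγ'δ
  exact h

/-- **`Γ_q`-INVARIANCE OF THE PIECE FUNCTION** (hypothesis `hf` of ★ `exists_lift_of_pieces`): for a `1`-form `α` on the algebraic-chart model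
of the piece `X_q`, a rational `δ` with `δ_f · g_q ∈ g_q · K` and `m v₀` negative, the cone read at `δ^τ · m` equals the cone read at `m`
(★ `conePullback_act`: `Γ_q` acts trivially through the uniformisation). [cite: Borel1997, §5.13–§5.14] [cite: Deligne1979ShimuraVarieties, 2.1.2] -/
theorem coneRead_ratToGLℂ_mul
    (hB : ∀ q, (B q).Hℂ = Jstar.map τ ∧
      (B q).Γ.map (Matrix.GeneralLinearGroup.map ((B q).τ₁ : ↥(B q).E →+* ℂ)) =
        (arithmeticLevel (↥(maximalRealSubfield L)) L (IsCMField.complexConj L) 2 Jstar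
          (K.1.1.map (MulAut.conj (gq q)).toMonoidHom)).map (Matrix.GeneralLinearGroup.map τ))
    (q : Q) (A : HodgeModel 1 (X q)) (α : MForm 𝓘(ℝ, A.model) A.carrier ℂ 1)
    {δ : ↥(rational (↥(maximalRealSubfield L)) L (IsCMField.complexConj L) 2 Jstar)}
    (hδ : ∃ k ∈ K.1.1, (rationalToFinAdelic (↥(maximalRealSubfield L)) L (IsCMField.complexConj L) 2 Jstar δ :
        ↥(finAdelic (↥(maximalRealSubfield L)) L (IsCMField.complexConj L) 2 Jstar)) * gq q = gq q * k)
    (v₀ t₀ : Fin 2 → ℂ) {m : Matrix (Fin 2) (Fin 2) ℂ} (hm : m *ᵥ v₀ ∈ negCone (Jstar.map τ)) :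
    α ((⇑A.isAnalytification.homeomorph.symm ∘ (B q).unif)
          ((((ratToGLℂ L Jstar τ δ : GL (Fin 2) ℂ) : Matrix (Fin 2) (Fin 2) ℂ) * m) *ᵥ v₀))
        (fun _ ↦ mfderiv 𝓘(ℝ, Fin 2 → ℂ) 𝓘(ℝ, A.model) (⇑A.isAnalytification.homeomorph.symm ∘ (B q).unif)
          ((((ratToGLℂ L Jstar τ δ : GL (Fin 2) ℂ) : Matrix (Fin 2) (Fin 2) ℂ) * m) *ᵥ v₀)
          ((((ratToGLℂ L Jstar τ δ : GL (Fin 2) ℂ) : Matrix (Fin 2) (Fin 2) ℂ) * m) *ᵥ t₀)) =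
      α ((⇑A.isAnalytification.homeomorph.symm ∘ (B q).unif) (m *ᵥ v₀))
        (fun _ ↦ mfderiv 𝓘(ℝ, Fin 2 → ℂ) 𝓘(ℝ, A.model) (⇑A.isAnalytification.homeomorph.symm ∘ (B q).unif) (m *ᵥ v₀) (m *ᵥ t₀)) := by
  obtain ⟨γ', hγ', hγ'δ⟩ := exists_mem_Γ_map_eq_ratToGLℂ (fun q => (hB q).2) q hδ
  have hm' : m *ᵥ v₀ ∈ (B q).cone := by
    change _ ∈ negCone (B q).Hℂ
    rw [(hB q).1]
    exact hm
  have h := (B q).conePullback_act A α hγ' hm' (m *ᵥ t₀)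
  have e1 : (B q).act γ' (m *ᵥ v₀) = (((ratToGLℂ L Jstar τ δ : GL (Fin 2) ℂ) : Matrix (Fin 2) (Fin 2) ℂ) * m) *ᵥ v₀ := by
    simp only [UnitaryBallUniformisationDatum.act, hγ'δ, Matrix.mulVec_mulVec]
  have e2 : (B q).act γ' (m *ᵥ t₀) = (((ratToGLℂ L Jstar τ δ : GL (Fin 2) ℂ) : Matrix (Fin 2) (Fin 2) ℂ) * m) *ᵥ t₀ := by
    simp only [UnitaryBallUniformisationDatum.act, hγ'δ, Matrix.mulVec_mulVec]
  rw [e1, e2] at h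
  exact h

/-- **The piece family `u ↦ P_{K,q}[α](ũ)` satisfies the invariance hypothesis `hf` of the adelic lift**: for `δ` with `δ_f · g_q = g_q · k`,
`k ∈ K`, `P_{K,q}[α]((σ(δ) u)~) = P_{K,q}[α](ũ)` (§1 + `coneRead_ratToGLℂ_mul`; `ũ v₀` is negative). [cite: BorelJacquet1979, §4.3]
[cite: Deligne1979ShimuraVarieties, 2.1.2] -/
theorem family_rationalToArchLocal_mul
    (hB : ∀ q, (B q).Hℂ = Jstar.map τ ∧
      (B q).Γ.map (Matrix.GeneralLinearGroup.map ((B q).τ₁ : ↥(B q).E →+* ℂ)) =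
        (arithmeticLevel (↥(maximalRealSubfield L)) L (IsCMField.complexConj L) 2 Jstar
          (K.1.1.map (MulAut.conj (gq q)).toMonoidHom)).map (Matrix.GeneralLinearGroup.map τ))
    (A : ∀ q, HodgeModel 1 (X q)) (α : ∀ q, MForm 𝓘(ℝ, (A q).model) (A q).carrier ℂ 1)
    {v₀ : Fin 2 → ℂ} (hv₀ : v₀ ∈ negCone (Jstar.map τ)) (t₀ : Fin 2 → ℂ)
    (q : Q) (δ : ↥(rational (↥(maximalRealSubfield L)) L (IsCMField.complexConj L) 2 Jstar))
    (hδ : ∃ k ∈ K.1.1, (rationalToFinAdelic (↥(maximalRealSubfield L)) L (IsCMField.complexConj L) 2 Jstar δ :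
        ↥(finAdelic (↥(maximalRealSubfield L)) L (IsCMField.complexConj L) 2 Jstar)) * gq q = gq q * k)
    (u : archLocal L 2 Jstar (cmPlace L τ)) :
    (α q) ((⇑(A q).isAnalytification.homeomorph.symm ∘ (B q).unif)
          ((((rationalToArchLocal (↥(maximalRealSubfield L)) L (IsCMField.complexConj L) 2 Jstar (cmPlace L τ)
              (complexConj_smul_infinitePlace L _) (IsCMField.complexConj_ne_one L) δ * u : archLocal L 2 Jstar (cmPlace L τ)) :
              GL (Fin 2) ℂ) : Matrix (Fin 2) (Fin 2) ℂ).map (embTwist L τ) *ᵥ v₀))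
        (fun _ ↦ mfderiv 𝓘(ℝ, Fin 2 → ℂ) 𝓘(ℝ, (A q).model) (⇑(A q).isAnalytification.homeomorph.symm ∘ (B q).unif)
          ((((rationalToArchLocal (↥(maximalRealSubfield L)) L (IsCMField.complexConj L) 2 Jstar (cmPlace L τ)
              (complexConj_smul_infinitePlace L _) (IsCMField.complexConj_ne_one L) δ * u : archLocal L 2 Jstar (cmPlace L τ)) :
              GL (Fin 2) ℂ) : Matrix (Fin 2) (Fin 2) ℂ).map (embTwist L τ) *ᵥ v₀)
          ((((rationalToArchLocal (↥(maximalRealSubfield L)) L (IsCMField.complexConj L) 2 Jstar (cmPlace L τ)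
              (complexConj_smul_infinitePlace L _) (IsCMField.complexConj_ne_one L) δ * u : archLocal L 2 Jstar (cmPlace L τ)) :
              GL (Fin 2) ℂ) : Matrix (Fin 2) (Fin 2) ℂ).map (embTwist L τ) *ᵥ t₀)) =
      (α q) ((⇑(A q).isAnalytification.homeomorph.symm ∘ (B q).unif) ((((u : GL (Fin 2) ℂ) : Matrix (Fin 2) (Fin 2) ℂ).map (embTwist L τ)) *ᵥ v₀))
        (fun _ ↦ mfderiv 𝓘(ℝ, Fin 2 → ℂ) 𝓘(ℝ, (A q).model) (⇑(A q).isAnalytification.homeomorph.symm ∘ (B q).unif)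
          ((((u : GL (Fin 2) ℂ) : Matrix (Fin 2) (Fin 2) ℂ).map (embTwist L τ)) *ᵥ v₀)
          ((((u : GL (Fin 2) ℂ) : Matrix (Fin 2) (Fin 2) ℂ).map (embTwist L τ)) *ᵥ t₀)) := by
  rw [map_embTwist_rationalToArchLocal_mul (τ := τ) δ u]
  exact coneRead_ratToGLℂ_mul hB q (A q) (α q) hδ v₀ t₀ (map_embTwist_mulVec_mem_negCone (τ := τ) u hv₀)

end Invariance

end Literature.AlgebraicGeometry.ShimuraVarieties.UnitaryCanonicalModel

end
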